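import Mathlib
import HarnessLib
import Summits.NavierStokesRegularity.NavierStokesRegularity.Theorems.PoloidalWindowDoorLrcModEntireTHCertDecode

/-!
# ARM-C cell T1′ (e,q) = (4,3) at tilt γ = −7/2 (C1a, level 7; ∂ₜ-blind identities; eng-2 psec kill export T1_4_3_gm7over2) — DATA part Data8 of 42 (identity rows; generated by kill2lean.py)

Row-encoded identities (`…THCertDecode` format) of the cell's (sub-)system; decoded and replayed in `PoloidalWindowDoorLrcModEntireJetCertPsatzElimCellT1E4Q3Gm7over2`.
WHAT THIS IS NOT: not a statement about Navier–Stokes; data of an exact census row of an ansatz class. [folklore]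
-/

-- the summit and its single sub-problem share the name (CONVENTIONS §1), as in every Theorems file
set_option linter.dupNamespace false

namespace Summit.NavierStokesRegularity.NavierStokesRegularity.Theorems.PoloidalWindowDoorLrcModEntireJetCertPsatzElimCellT1E4Q3Gm7over2Data8

/-- identity 92 (8 terms; rows `[sgn, num, den, letter, exp, …]`). [folklore] -/
def rows_92 : List (List ℕ) := [[0, 6, 1, 6, 1, 14, 1, 19, 1], [0, 6, 1, 6, 1, 17, 1, 18, 1], [0, 6, 1, 7, 1, 13, 1, 19, 1], [0, 3, 1, 7, 1, 17, 2], [0, 3, 1, 13, 2, 18, 1], [0, 6, 1, 13, 1, 14, 1, 17, 1], [0, 2, 1, 137, 1], [0, 30, 1, 139, 1]]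

end Summit.NavierStokesRegularity.NavierStokesRegularity.Theorems.PoloidalWindowDoorLrcModEntireJetCertPsatzElimCellT1E4Q3Gm7over2Data8
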